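import Mathlib
import Literature.NumberTheory.LFunctions.Zhang2022.SkeletonPartThree
import HarnessLib

/-!
# Zhang (2022), §16 (16.11): the residues `𝓡₂₁`, `𝓡₂₂` of
# `ζ(1+s+β₁)/(ζ(1+s)L(1+s,χ)) · P₄^{s+β₂}ω₁(s+β₂)/(s+β₂)` at `s = −β₁`, `s = −β₂`, identified in
# closed form — kernel-checked

Topic `Literature/NumberTheory/LFunctions/Zhang2022` (Landau–Siegel audit tree; verdict-neutral).
Y. Zhang, *Discrete mean estimates and the Landau–Siegel zero*, arXiv:2211.02515v1 (2022)
[Zhang2022LandauSiegel] — **an unrefereed manuscript under adjudication**. §16 p. 92, (16.10)–(16.11)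
(tex L4550–L4556, DAG `Z22:(16.11)`):

> where `𝓡₂ⱼ`, `j = 1,2`, is the residue of the function
> `ζ(1+s+β₁)/(ζ(1+s)L(1+s,χ)) · P₄^{s+β₂}ω₁(s+β₂)/(s+β₂)` (16.11) at `s = −β_j`.

The typed object (`Typed.Section16A.calR2 c′ χ j`, L4 convention) is the simple-pole residue
`lim_{s→−β_j, s≠−β_j} (s + β_j)·(16.11)(s)` (`limUnder` over the punctured neighbourhood; the
function (16.11) is written out in each statement below, parameters `β₁, β₂, P = P₄, Λ = 𝓛³⁰`
explicit, so that `Typed.Section16A.F1611 c′ χ` is an instance by `rfl`). This file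
identifies the two limits in closed form, for ARBITRARY parameters (`β₁ ≠ β₂` non-zero, `P₄ > 0`, any
Gaussian width), under the non-vanishing of the denominators at the pole — the first half of the
manuscript's "by Lemma 5.8 and direct calculation, `𝓡₂ⱼ = −1/(β₁L′(1,χ)) + O(𝓛⁶)`" (§16 p. 95,
tex L4674, DAG `Z22:§16.u043`); the estimate of the closed forms is the companion file
`Section16ResidueValues`:

* `tendsto_residue1611_one` / `residue1611_one_eq` — at `s = −β₁` the factor `(s+β₁)ζ(1+s+β₁) → 1`
  (Mathlib `riemannZeta_residue_one`) and the rest is continuous, so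
  `𝓡₂₁ = [ζ(1−β₁)L(1−β₁,χ)]⁻¹ · P₄^{β₂−β₁}ω₁(β₂−β₁)/(β₂−β₁)`;
* `tendsto_residue1611_two` / `residue1611_two_eq` — at `s = −β₂` the pole is the factor `(s+β₂)⁻¹`,
  so `𝓡₂₂ = ζ(1+β₁−β₂)/(ζ(1−β₂)L(1−β₂,χ)) · ω₁(0)·P₄⁰ = ζ(1+β₁−β₂)/(ζ(1−β₂)L(1−β₂,χ))`.

Nothing else of §16 is asserted; nothing about Theorems 1–2 of the source.

## References

* Y. Zhang, arXiv:2211.02515v1 (2022), §16 (16.10)–(16.11) p. 92, p. 95. [cite: Zhang2022LandauSiegel, §16 (16.11)]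
-/

noncomputable section

open Complex Real Filter Topology

namespace Literature.NumberTheory.LFunctions.Zhang2022.Skeleton

section ResidueLimits

variable {D : ℕ} [NeZero D] (χ : DirichletCharacter ℂ D)

/-- The shift `s ↦ 1 + s + β₁` maps the punctured neighbourhood of `−β₁` into the punctured
neighbourhood of `1`. [folklore] -/
private theorem tendsto_shift_puncture (β₁ : ℂ) :
    Tendsto (fun s : ℂ => 1 + s + β₁) (𝓝[≠] (-β₁)) (𝓝[≠] 1) := by
  refine tendsto_nhdsWithin_iff.mpr ⟨?_, ?_⟩
  · have : Continuous fun s : ℂ => 1 + s + β₁ := by fun_prop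
    have h := (this.tendsto (-β₁))
    rw [show (1 : ℂ) + -β₁ + β₁ = 1 by ring] at h
    exact h.mono_left nhdsWithin_le_nhds
  · refine eventually_nhdsWithin_of_forall fun s hs => ?_
    simp only [Set.mem_compl_iff, Set.mem_singleton_iff] at hs ⊢
    intro h; apply hs
    linear_combination h

/-- `(s + β₁)ζ(1 + s + β₁) → 1` as `s → −β₁` (the simple pole of `ζ` at `1`, residue `1`).
[folklore] -/
private theorem tendsto_mul_zeta_shift (β₁ : ℂ) :
    Tendsto (fun s : ℂ => (s + β₁) * riemannZeta (1 + s + β₁)) (𝓝[≠] (-β₁)) (𝓝 1) := by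
  have h := riemannZeta_residue_one.comp (tendsto_shift_puncture β₁)
  refine h.congr' (Eventually.of_forall fun s => ?_)
  simp only [Function.comp_apply]
  ring_nf

/-- Continuity of the regular factor at a point where the denominators do not vanish. [folklore] -/
private theorem continuousAt_regular {β₂ : ℂ} {P Λ : ℝ} (hχ : χ ≠ 1) (hP : 0 < P) {a : ℂ}
    (ha1 : 1 + a ≠ 1) (hζ : riemannZeta (1 + a) ≠ 0) (hL : χ.LFunction (1 + a) ≠ 0)
    (hβ : a + β₂ ≠ 0) :
    ContinuousAt (fun s : ℂ => (riemannZeta (1 + s) * χ.LFunction (1 + s))⁻¹ *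
      ((P : ℂ) ^ (s + β₂) * GaussWeight.omega1 Λ (s + β₂) / (s + β₂))) a := by
  have hζc : ContinuousAt (fun s : ℂ => riemannZeta (1 + s)) a :=
    ((differentiableAt_riemannZeta ha1).continuousAt).comp (by fun_prop)
  have hLc : ContinuousAt (fun s : ℂ => χ.LFunction (1 + s)) a :=
    ((DirichletCharacter.differentiable_LFunction hχ).continuous.continuousAt).comp (by fun_prop)
  have hinv : ContinuousAt (fun s : ℂ => (riemannZeta (1 + s) * χ.LFunction (1 + s))⁻¹) a :=
    (hζc.mul hLc).inv₀ (mul_ne_zero hζ hL)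
  have hP0 : (P : ℂ) ≠ 0 := ofReal_ne_zero.mpr hP.ne'
  have hcpow : ContinuousAt (fun s : ℂ => (P : ℂ) ^ (s + β₂)) a :=
    (continuousAt_const_cpow hP0).comp (by fun_prop)
  have hω : ContinuousAt (fun s : ℂ => GaussWeight.omega1 Λ (s + β₂)) a := by
    unfold GaussWeight.omega1; fun_prop
  have hden : ContinuousAt (fun s : ℂ => s + β₂) a := by fun_prop
  exact hinv.mul ((hcpow.mul hω).div hden hβ)

/-- **`𝓡₂₁` as a limit**: if `β₁ ≠ 0`, `β₁ ≠ β₂`, `P > 0`, `χ ≠ 1`, `ζ(1−β₁) ≠ 0`, `L(1−β₁,χ) ≠ 0`,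
then `(s + β₁)·(16.11)(s) → [ζ(1−β₁)L(1−β₁,χ)]⁻¹ · P^{β₂−β₁}ω₁(β₂−β₁)/(β₂−β₁)` as `s → −β₁`, `s ≠ −β₁`.
[cite: Zhang2022LandauSiegel, §16 (16.11) p.92] -/
theorem tendsto_residue1611_one {β₁ β₂ : ℂ} {P Λ : ℝ} (hχ : χ ≠ 1) (hP : 0 < P) (hβ1 : β₁ ≠ 0)
    (hβ : β₁ ≠ β₂) (hζ : riemannZeta (1 - β₁) ≠ 0) (hL : χ.LFunction (1 - β₁) ≠ 0) :
    Tendsto (fun s => (s + β₁) *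
      (riemannZeta (1 + s + β₁) / (riemannZeta (1 + s) * χ.LFunction (1 + s)) *
        ((P : ℂ) ^ (s + β₂) * GaussWeight.omega1 Λ (s + β₂) / (s + β₂)))) (𝓝[≠] (-β₁))
      (𝓝 ((riemannZeta (1 - β₁) * χ.LFunction (1 - β₁))⁻¹ *
        ((P : ℂ) ^ (β₂ - β₁) * GaussWeight.omega1 Λ (β₂ - β₁) / (β₂ - β₁)))) := by
  have ha1 : (1 : ℂ) + -β₁ ≠ 1 := by
    intro h; apply hβ1; linear_combination -h
  have hζ' : riemannZeta (1 + -β₁) ≠ 0 := by rwa [← sub_eq_add_neg]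
  have hL' : χ.LFunction (1 + -β₁) ≠ 0 := by rwa [← sub_eq_add_neg]
  have hβ' : -β₁ + β₂ ≠ 0 := by
    intro h; apply hβ; linear_combination -h
  have hreg := ((continuousAt_regular χ (Λ := Λ) hχ hP ha1 hζ' hL' hβ').tendsto).mono_left
    (nhdsWithin_le_nhds (s := ({-β₁}ᶜ : Set ℂ)))
  have hprod := (tendsto_mul_zeta_shift β₁).mul hreg
  rw [one_mul, show (1 : ℂ) + -β₁ = 1 - β₁ by ring, show -β₁ + β₂ = β₂ - β₁ by ring] at hprod
  refine hprod.congr' (Eventually.of_forall fun s => ?_)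
  simp only [div_eq_mul_inv]
  ring

/-- **`𝓡₂₁` in closed form**: under the hypotheses of `tendsto_residue1611_one`,
`lim_{s→−β₁, s≠−β₁} (s+β₁)·(16.11)(s) = [ζ(1−β₁)L(1−β₁,χ)]⁻¹·P^{β₂−β₁}ω₁(β₂−β₁)/(β₂−β₁)`.
[cite: Zhang2022LandauSiegel, §16 (16.11) p.92] -/
theorem residue1611_one_eq {β₁ β₂ : ℂ} {P Λ : ℝ} (hχ : χ ≠ 1) (hP : 0 < P) (hβ1 : β₁ ≠ 0)
    (hβ : β₁ ≠ β₂) (hζ : riemannZeta (1 - β₁) ≠ 0) (hL : χ.LFunction (1 - β₁) ≠ 0) :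
    limUnder (𝓝[≠] (-β₁)) (fun s => (s + β₁) *
      (riemannZeta (1 + s + β₁) / (riemannZeta (1 + s) * χ.LFunction (1 + s)) *
        ((P : ℂ) ^ (s + β₂) * GaussWeight.omega1 Λ (s + β₂) / (s + β₂)))) =
      (riemannZeta (1 - β₁) * χ.LFunction (1 - β₁))⁻¹ *
        ((P : ℂ) ^ (β₂ - β₁) * GaussWeight.omega1 Λ (β₂ - β₁) / (β₂ - β₁)) :=
  (tendsto_residue1611_one χ hχ hP hβ1 hβ hζ hL).limUnder_eq

/-- **`𝓡₂₂` as a limit**: if `β₂ ≠ 0`, `β₁ ≠ β₂`, `P > 0`, `χ ≠ 1`, `ζ(1−β₂) ≠ 0`, `L(1−β₂,χ) ≠ 0`,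
then `(s + β₂)·(16.11)(s) → ζ(1+β₁−β₂)/(ζ(1−β₂)L(1−β₂,χ))` as `s → −β₂`, `s ≠ −β₂`
(`P⁰ = ω₁(0) = 1`). [cite: Zhang2022LandauSiegel, §16 (16.11) p.92] -/
theorem tendsto_residue1611_two {β₁ β₂ : ℂ} {P Λ : ℝ} (hχ : χ ≠ 1) (hP : 0 < P) (hβ2 : β₂ ≠ 0)
    (hβ : β₁ ≠ β₂) (hζ : riemannZeta (1 - β₂) ≠ 0) (hL : χ.LFunction (1 - β₂) ≠ 0) :
    Tendsto (fun s => (s + β₂) *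
      (riemannZeta (1 + s + β₁) / (riemannZeta (1 + s) * χ.LFunction (1 + s)) *
        ((P : ℂ) ^ (s + β₂) * GaussWeight.omega1 Λ (s + β₂) / (s + β₂)))) (𝓝[≠] (-β₂))
      (𝓝 (riemannZeta (1 + β₁ - β₂) / (riemannZeta (1 - β₂) * χ.LFunction (1 - β₂)))) := by
  have hP0 : (P : ℂ) ≠ 0 := ofReal_ne_zero.mpr hP.ne'
  -- the cancelled function
  set H : ℂ → ℂ := fun s => riemannZeta (1 + s + β₁) / (riemannZeta (1 + s) * χ.LFunction (1 + s)) *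
    ((P : ℂ) ^ (s + β₂) * GaussWeight.omega1 Λ (s + β₂)) with hH
  have hHc : ContinuousAt H (-β₂) := by
    have h1 : (1 : ℂ) + -β₂ + β₁ ≠ 1 := by
      intro h; apply hβ; linear_combination h
    have h2 : (1 : ℂ) + -β₂ ≠ 1 := by
      intro h; apply hβ2; linear_combination -h
    have hζn : ContinuousAt (fun s : ℂ => riemannZeta (1 + s + β₁)) (-β₂) := by
      have hc : ContinuousAt riemannZeta (1 + -β₂ + β₁) :=
        (differentiableAt_riemannZeta h1).continuousAt
      exact hc.comp (f := fun s : ℂ => 1 + s + β₁) (by fun_prop)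
    have hζd : ContinuousAt (fun s : ℂ => riemannZeta (1 + s)) (-β₂) :=
      ((differentiableAt_riemannZeta h2).continuousAt).comp (by fun_prop)
    have hLd : ContinuousAt (fun s : ℂ => χ.LFunction (1 + s)) (-β₂) :=
      ((DirichletCharacter.differentiable_LFunction hχ).continuous.continuousAt).comp (by fun_prop)
    have hζ' : riemannZeta (1 + -β₂) ≠ 0 := by rwa [← sub_eq_add_neg]
    have hL' : χ.LFunction (1 + -β₂) ≠ 0 := by rwa [← sub_eq_add_neg]
    have hcpow : ContinuousAt (fun s : ℂ => (P : ℂ) ^ (s + β₂)) (-β₂) :=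
      (continuousAt_const_cpow hP0).comp (by fun_prop)
    have hω : ContinuousAt (fun s : ℂ => GaussWeight.omega1 Λ (s + β₂)) (-β₂) := by
      unfold GaussWeight.omega1; fun_prop
    exact (hζn.div (hζd.mul hLd) (mul_ne_zero hζ' hL')).mul (hcpow.mul hω)
  have hval : H (-β₂) = riemannZeta (1 + β₁ - β₂) / (riemannZeta (1 - β₂) * χ.LFunction (1 - β₂)) := by
    simp only [hH, neg_add_cancel, Complex.cpow_zero, GaussWeight.omega1, one_mul]
    rw [show ((0 : ℂ) ^ 2 / ((4 * Λ : ℝ) : ℂ)) = 0 by simp, Complex.exp_zero, mul_one]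
    ring_nf
  have hlim := hHc.tendsto.mono_left (nhdsWithin_le_nhds (s := ({-β₂}ᶜ : Set ℂ)))
  rw [hval] at hlim
  refine hlim.congr' ?_
  refine eventually_nhdsWithin_of_forall fun s hs => ?_
  have hs' : s + β₂ ≠ 0 := by
    simp only [Set.mem_compl_iff, Set.mem_singleton_iff] at hs
    intro h; apply hs; linear_combination h
  simp only [hH]
  field_simp

/-- **`𝓡₂₂` in closed form**: under the hypotheses of `tendsto_residue1611_two`,
`lim_{s→−β₂, s≠−β₂} (s+β₂)·(16.11)(s) = ζ(1+β₁−β₂)/(ζ(1−β₂)L(1−β₂,χ))`.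
[cite: Zhang2022LandauSiegel, §16 (16.11) p.92] -/
theorem residue1611_two_eq {β₁ β₂ : ℂ} {P Λ : ℝ} (hχ : χ ≠ 1) (hP : 0 < P) (hβ2 : β₂ ≠ 0)
    (hβ : β₁ ≠ β₂) (hζ : riemannZeta (1 - β₂) ≠ 0) (hL : χ.LFunction (1 - β₂) ≠ 0) :
    limUnder (𝓝[≠] (-β₂)) (fun s => (s + β₂) *
      (riemannZeta (1 + s + β₁) / (riemannZeta (1 + s) * χ.LFunction (1 + s)) *
        ((P : ℂ) ^ (s + β₂) * GaussWeight.omega1 Λ (s + β₂) / (s + β₂)))) =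
      riemannZeta (1 + β₁ - β₂) / (riemannZeta (1 - β₂) * χ.LFunction (1 - β₂)) :=
  (tendsto_residue1611_two χ hχ hP hβ2 hβ hζ hL).limUnder_eq

end ResidueLimits

end Literature.NumberTheory.LFunctions.Zhang2022.Skeleton
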